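import Mathlib.Combinatorics.SimpleGraph.Connectivity.Connected
import Literature.Combinatorics.SimpleGraph.SwitchingEquivalentGraph

/-!
# Switching closure of removed material (the per-path Corneil–Goldberg bound, `NoHiddenOrder`, stmt-PneNP-14781)

Route `PneNP/SymmetryBudget`, dichotomy `NoHiddenOrder` (stmt-PneNP-14781) / `WindowBarrier` (stmt-PneNP-2145); memo
`PER-PATH.md` §10, Lemma 3 — the engine of THEOREM B there (on every root–leaf path of the Corneil–Goldberg recursion tree
the number of OR-nodes with smallest cell `> n/q` is `≤ 3q + 1`, hence `Σ_OR log₂ d ≤ 4.1 n`; with the per-path reduction,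
Theorem A, this yields `NoHiddenOrder`). Setting: `ρ` an equitable colouring of `G`, `L` a set of vertices ("removed between
two consecutive fat OR-nodes") such that, for every cell `X` of `ρ`, (H2) less than half of `X` is in `L` and (Hom) every
`m ∈ L` is complete or empty towards `X ∖ L` (it was cut off by a section whose other side kept `X ∖ L` inside one cell).

* `PerPath.not_swAdj_of_hom` — then NO edge of the switching-equivalent graph `G_ρ` (Laubner 2011, Def. 3.3.2) leaves `L`:
  an empty block towards `X ∖ L` has fewer than `|X|/2` neighbours in `X` and is kept, a complete one has more and is
  switched; either way the switching neighbours of `m` in `X` lie in `X ∩ L`.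
* `PerPath.forall_not_mem_of_preconnected` — hence if `G_ρ` is connected (as at every OR-node: components are sections)
  then `L = ∅`. Contrapositively: the (non-empty) material removed between two consecutive fat OR-nodes forces some fat
  cell to SPLIT (Hom fails only if `X ∖ L` meets two later cells), to DIE or to lose at least half (H2 fails) — each a unit
  of the potential `#cells + 2·|removed|/D ≤ 3q`, which bounds the fat OR-nodes of a path.

No definitions; Mathlib + the tree's `IsEquitable` / `swGraph` / `cellCard` / `adjCount`.
-/

-- `Summit.PneNP.PneNP.…` duplicates `PneNP` BY DESIGN (single-problem summit, D-0017 layout).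
set_option linter.dupNamespace false

namespace Summit.PneNP.PneNP.Theorems

namespace PerPath

open Finset Literature.Combinatorics.SimpleGraph

variable {V : Type*} [Fintype V]
variable {G : SimpleGraph V} [DecidableRel G.Adj]
variable {κ : Type*} [DecidableEq κ]

/-- **Switching closure** (PER-PATH.md Lemma 3). Let `ρ` be equitable and `L` a set of vertices such that every cell
has less than half of its vertices in `L` (H2) and every `m ∈ L` is complete or empty towards the part of every cell
outside `L` (Hom). Then no edge of the switching-equivalent graph `G_ρ` goes from `L` to its complement. -/
theorem not_swAdj_of_hom {ρ : V → κ} (hρ : IsEquitable G ρ) {L : Set V} [DecidablePred (· ∈ L)]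
    (hH2 : ∀ x : V, 2 * (univ.filter fun w => ρ w = ρ x ∧ w ∈ L).card < cellCard ρ (ρ x))
    (hHom : ∀ m, m ∈ L → ∀ x : V,
      (∀ v, ρ v = ρ x → v ∉ L → G.Adj m v) ∨ (∀ v, ρ v = ρ x → v ∉ L → ¬ G.Adj m v))
    {m w : V} (hm : m ∈ L) (hw : w ∉ L) : ¬ (swGraph G ρ).Adj m w := by
  intro hadj
  have hne : m ≠ w := (swGraph_adj.1 hadj).1
  have hsw : G.Adj m w ↔ ¬ Switch G ρ (ρ m) (ρ w) := (swGraph_adj.1 hadj).2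
  have hS : Switch G ρ (ρ m) (ρ w) ↔ cellCard ρ (ρ w) < 2 * adjCount G ρ m (ρ w) :=
    switch_iff_of_isEquitable hρ m (ρ w)
  set k : κ := ρ w with hk
  set T : Finset V := univ.filter fun v => ρ v = k ∧ v ∈ L with hT
  have h2 : 2 * T.card < cellCard ρ k := hH2 w
  -- the cell of `w` splits into `T` and the outside part
  have hcell : cellCard ρ k = T.card + (univ.filter fun v => ρ v = k ∧ v ∉ L).card := by
    unfold cellCard
    rw [← card_filter_add_card_filter_not (p := fun v => v ∈ L), filter_filter, filter_filter]
  rcases hHom m hm w with hfull | hempty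
  · -- complete towards `X_k \ L`: many neighbours, the block is switched, but `m w ∈ E` says it is kept
    have hadjG : G.Adj m w := hfull w rfl hw
    have hnotS : ¬ cellCard ρ k < 2 * adjCount G ρ m k := fun h => (hsw.1 hadjG) (hS.2 h)
    have hle : (univ.filter fun v => ρ v = k ∧ v ∉ L).card ≤ adjCount G ρ m k :=
      card_le_card fun v hv => by
        simp only [mem_filter, mem_univ, true_and] at hv ⊢
        exact ⟨hfull v hv.1 hv.2, hv.1⟩
    omega
  · -- empty towards `X_k \ L`: few neighbours, the block is kept, but `m w ∉ E` says it is switched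
    have hnadj : ¬ G.Adj m w := hempty w rfl hw
    have hSw : cellCard ρ k < 2 * adjCount G ρ m k := hS.1 (by
      by_contra h
      exact hnadj (hsw.2 h))
    have hle : adjCount G ρ m k ≤ T.card :=
      card_le_card fun v hv => by
        simp only [hT, mem_filter, mem_univ, true_and] at hv ⊢
        refine ⟨hv.2, ?_⟩
        by_contra hvL
        exact hempty v hv.2 hvL hv.1
    omega

/-- **Hence, if the switching graph is connected, `L` is empty** (PER-PATH.md Lemma 3, conclusion): a non-empty `L`
closed under `G_ρ`-adjacency would be everything, contradicting (H2) in any cell. -/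
theorem forall_not_mem_of_preconnected {ρ : V → κ} (hρ : IsEquitable G ρ) {L : Set V} [DecidablePred (· ∈ L)]
    (hH2 : ∀ x : V, 2 * (univ.filter fun w => ρ w = ρ x ∧ w ∈ L).card < cellCard ρ (ρ x))
    (hHom : ∀ m, m ∈ L → ∀ x : V,
      (∀ v, ρ v = ρ x → v ∉ L → G.Adj m v) ∨ (∀ v, ρ v = ρ x → v ∉ L → ¬ G.Adj m v))
    (hconn : (swGraph G ρ).Preconnected) (m : V) : m ∉ L := by
  intro hm
  -- every vertex is reachable from `m`, and `L` is closed under switching adjacency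
  have hall : ∀ w : V, w ∈ L := by
    intro w
    obtain ⟨p⟩ := hconn m w
    suffices key : ∀ {a b : V} (p' : (swGraph G ρ).Walk a b), a ∈ L → b ∈ L from key p hm
    intro a b p'
    induction p' with
    | nil => exact id
    | cons h _ ih =>
      intro ha
      refine ih ?_
      by_contra hb
      exact not_swAdj_of_hom hρ hH2 hHom ha hb h
  -- so the cell of `m` lies in `L`, contradicting (H2)
  have hle : cellCard ρ (ρ m) ≤ (univ.filter fun w => ρ w = ρ m ∧ w ∈ L).card :=
    card_le_card fun w hw => by
      simp only [mem_filter, mem_univ, true_and] at hw ⊢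
      exact ⟨hw, hall w⟩
  have := hH2 m
  omega

/-- **Progress between consecutive fat OR-nodes** (PER-PATH.md Theorem B, step (2)). Let `ρ` be equitable with connected
switching graph (an OR-node), and let a later node keep the vertex set `U''` with a colouring `ρ''` (in the application a
refinement of `ρ` on `U''`), every removed vertex being complete or empty towards each later cell (cut off by sections). If some vertex
was removed, then some cell `X` of `ρ` either SPLITS (meets two `ρ''`-classes inside `U''`) or loses at least half of its
vertices (`|X| ≤ 2|X ∖ U''|`; this includes death, `X ∩ U'' = ∅`). -/
theorem exists_split_or_heavy {ρ : V → κ} (hρ : IsEquitable G ρ) (hconn : (swGraph G ρ).Preconnected)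
    {κ'' : Type*} (ρ'' : V → κ'') (U'' : Set V) [DecidablePred (· ∈ U'')]
    (hHom : ∀ m, m ∉ U'' → ∀ x, x ∈ U'' →
      (∀ v, v ∈ U'' → ρ'' v = ρ'' x → G.Adj m v) ∨ (∀ v, v ∈ U'' → ρ'' v = ρ'' x → ¬ G.Adj m v))
    {x₀ : V} (hx₀ : x₀ ∉ U'') :
    ∃ x : V, (∃ u v, u ∈ U'' ∧ v ∈ U'' ∧ ρ u = ρ x ∧ ρ v = ρ x ∧ ρ'' u ≠ ρ'' v) ∨
      cellCard ρ (ρ x) ≤ 2 * (univ.filter fun w => ρ w = ρ x ∧ w ∉ U'').card := by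
  classical
  by_contra h
  push Not at h
  -- `L := V \ U''` satisfies (H2) and (Hom) of the switching-closure lemma
  have key := forall_not_mem_of_preconnected (L := {w | w ∉ U''}) hρ (fun x => ?_) (fun m hm x => ?_) hconn x₀
  · exact key hx₀
  · have := (h x).2
    simpa only [Set.mem_setOf_eq] using this
  · simp only [Set.mem_setOf_eq, not_not] at hm ⊢
    by_cases hX : ∃ x₁, ρ x₁ = ρ x ∧ x₁ ∈ U''
    · obtain ⟨x₁, hx₁, hx₁U⟩ := hX
      rcases hHom m hm x₁ hx₁U with hfull | hempty
      · exact Or.inl fun v hv hvU => hfull v hvU ((h x).1 v x₁ hvU hx₁U hv hx₁)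
      · exact Or.inr fun v hv hvU => hempty v hvU ((h x).1 v x₁ hvU hx₁U hv hx₁)
    · push Not at hX
      exact Or.inl fun v hv hvU => absurd hvU (hX v hv)

end PerPath

end Summit.PneNP.PneNP.Theorems
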